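import Summits.SmoothPoincare4.SmoothPoincare4.Theses.DiophantineRotations
import Literature.Topology.FourManifolds.PalaisBallComplement
import HarnessLib

/-!
# `DiophantineRigidity` — negative knowledge I: shape of the crux (it is the summit in costume)

Strategist (r1, redirect scan) support file for crux `stmt-SmoothPoincare4-16607`
(`Summit.SmoothPoincare4.SmoothPoincare4.Theses.DiophantineRotations.DiophantineRigidity`, "K1") of route
`route-SmoothPoincare4-DiophantineRotations` (deciding theorem `closes : K1 → K2 → SmoothPoincare4`,
K2 = `QuasiPeriodicExistence`, target `Target = K1 ∧ K2`).  Pure logic over the route's own declarations,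
plus one certified Diophantine pair; nothing here closes an item.

K1 factors as the conjunction of two statements of different nature:

* `DiophantineRecognition` ("K1_rec"): the hypotheses of K1 with the NON-equivariant conclusion
  `Nonempty (M ≃ₘ S⁴)` — an instance of the SPC4-shielded shape `∀ M ≃ₜ S⁴, P M → M ≅ S⁴`
  (`Literature/Barriers/SmoothPoincare4/BARRIERS.lean` §D.1);
* `HermanRigiditySphereFour` ("K1_dyn"): K1 on the standard `S⁴` only — Herman's global `C⁰ ⇒ C^∞`
  rigidity problem for Diophantine bi-rotations of the round 4-sphere; no exotic smooth structure enters.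

Theorems (all `[folklore]`):

* §1 `diophantineRigidity_iff : K1 ↔ K1_rec ∧ K1_dyn`;
* §2 `spc4_imp_recognition : SmoothPoincare4 → K1_rec` (shielding) and
  `spc4_of_recognition_of_existence : K1_rec → K2 → SmoothPoincare4` (the route's `closes` never uses the
  equivariance of `θ`: K1_dyn is not load-bearing for the summit);
* §3–§4 the bi-rotation `R_{α,β}` as a `Diffeomorph` of `S⁴` (`birotSphere`) and a certified simultaneously
  Diophantine pair `(2^{1/3}, 4^{1/3})`, `τ = 2`, `γ = 1/25` (`diophantine_of_pow_three_eq_two`,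
  `isDiophantinePair_cbrt2`: Liouville's inequality for `ℚ(2^{1/3})` by 2-adic descent on the norm form);
* §5 `spc4_imp_quasiPeriodicExistence : SmoothPoincare4 → K2` (`F := θ⁻¹ ∘ R ∘ θ`, `h := θ`), hence
  `recognition_and_existence_iff_spc4 : K1_rec ∧ K2 ↔ SmoothPoincare4` (an unassigned conjunct split: both
  load-bearing pieces are implied by the summit), `target_iff : Target ↔ SmoothPoincare4 ∧ K1_dyn`,
  `quasiPeriodicExistence_iff_spc4_of_rigidity : K1 → (K2 ↔ SmoothPoincare4)` and
  `diophantineRigidity_iff_herman_of_spc4 : SmoothPoincare4 → (K1 ↔ K1_dyn)`.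

Reading.  The part of K1 that bears on the summit is SPC4 restricted to the class of smooth homotopy 4-spheres
carrying a `C⁰`-linearisable Diophantine diffeomorphism (no tool and no witness short of SPC4: every setting in
which the symmetry is genuinely smooth is Fintushel–Pao, `CircleActionBarrierFour`), and the rest of K1 is an
independent open problem of smooth dynamics (Fayad–Krikorian 2009, Question 1, where Herman expected a
counterexample already in dimension 2) that the deciding theorem discards.  Probes (strategist folder
`bc/K1_probe.lean`): `K1 → SmoothPoincare4` and `SmoothPoincare4 → K1` both FAIL under
`exact? | simpa | aesop` (K1 is neither cheaply the summit nor cheaply implied by it — because of K1_dyn).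
-/

noncomputable section

set_option linter.dupNamespace false

namespace Summit.SmoothPoincare4.SmoothPoincare4.Theorems.DiophantineRigidity.Negative

open scoped Manifold ContDiff Topology ContinuousMap RealInnerProductSpace
open Summit.SmoothPoincare4.SmoothPoincare4.Theses.DiophantineRotations

/-! ## §0 Vocabulary -/

/-- The standard smooth 4-sphere of the summit statement. -/
local notation "𝕊⁴" => (Metric.sphere (0 : EuclideanSpace ℝ (Fin 5)) 1)

/-- The ambient Euclidean 5-space. -/
local notation "ℝ⁵" => EuclideanSpace ℝ (Fin 5)

/-- The simultaneous Diophantine condition on `(α, β)`, verbatim from the route file. -/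
def IsDiophantinePair (α β : ℝ) : Prop :=
  ∃ γ τ : ℝ, 0 < γ ∧ ∀ k₁ k₂ m : ℤ, (k₁ ≠ 0 ∨ k₂ ≠ 0) →
    γ ≤ |(k₁ : ℝ) * α + (k₂ : ℝ) * β + (m : ℝ)| * (|(k₁ : ℝ)| + |(k₂ : ℝ)|) ^ τ

/-- The linear bi-rotation `R_{α,β}` of `ℝ⁵ = ℂ ⊕ ℂ ⊕ ℝ` in coordinates, verbatim from the route file. -/
def birot (α β : ℝ) (y : ℝ⁵) : ℝ⁵ :=
  WithLp.toLp 2 ![Real.cos (2 * Real.pi * α) * y 0 - Real.sin (2 * Real.pi * α) * y 1,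
    Real.sin (2 * Real.pi * α) * y 0 + Real.cos (2 * Real.pi * α) * y 1,
    Real.cos (2 * Real.pi * β) * y 2 - Real.sin (2 * Real.pi * β) * y 3,
    Real.sin (2 * Real.pi * β) * y 2 + Real.cos (2 * Real.pi * β) * y 3, y 4]

/-- `e` intertwines the self-map `F` of `M` with the bi-rotation: `e ∘ F = R_{α,β} ∘ e` in coordinates. -/
def Intertwines {M : Type} (F : M → M) (e : M → 𝕊⁴) (α β : ℝ) : Prop :=
  ∀ x : M, ((e (F x) : 𝕊⁴) : ℝ⁵) = birot α β (e x : ℝ⁵)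

/-- **K1_rec** — `DiophantineRigidity` with the non-equivariant conclusion: a smooth 4-manifold carrying a
diffeomorphism `C⁰`-conjugate (through a homeomorphism to `S⁴`) to a Diophantine bi-rotation is diffeomorphic
to `S⁴`.  This is the only part of K1 the route's deciding theorem uses. -/
def DiophantineRecognition : Prop :=
  ∀ (M : Type) [TopologicalSpace M] [T2Space M] [SecondCountableTopology M]
    [ChartedSpace (EuclideanSpace ℝ (Fin 4)) M] [IsManifold (𝓡 4) (⊤ : ℕ∞) M]
    (F : Diffeomorph (𝓡 4) (𝓡 4) M M (⊤ : ℕ∞)) (h : M ≃ₜ 𝕊⁴) (α β : ℝ),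
    IsDiophantinePair α β → Intertwines F h α β → Nonempty (Diffeomorph (𝓡 4) (𝓡 4) M 𝕊⁴ (⊤ : ℕ∞))

/-- **K1_dyn** — Herman's global rigidity problem on the standard 4-sphere: a diffeomorphism of `S⁴` that is
`C⁰`-conjugate to a Diophantine bi-rotation is `C^∞`-conjugate to it.  No exotic smooth structure enters. -/
def HermanRigiditySphereFour : Prop :=
  ∀ (F : Diffeomorph (𝓡 4) (𝓡 4) 𝕊⁴ 𝕊⁴ (⊤ : ℕ∞)) (h : 𝕊⁴ ≃ₜ 𝕊⁴) (α β : ℝ),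
    IsDiophantinePair α β → Intertwines F h α β →
      ∃ θ : Diffeomorph (𝓡 4) (𝓡 4) 𝕊⁴ 𝕊⁴ (⊤ : ℕ∞), Intertwines F θ α β

/-! ## §1 `K1 ↔ K1_rec ∧ K1_dyn` -/

/-- K1 ⇒ K1_rec: forget the equivariance of `θ`. [folklore] -/
theorem diophantineRigidity_imp_recognition (hK : DiophantineRigidity) : DiophantineRecognition := by
  intro M _ _ _ _ _ F h α β hD hc
  obtain ⟨θ, -⟩ := hK M F h α β hD hc
  exact ⟨θ⟩

/-- K1 ⇒ K1_dyn: specialise `M := S⁴`. [folklore] -/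
theorem diophantineRigidity_imp_herman (hK : DiophantineRigidity) : HermanRigiditySphereFour := by
  intro F h α β hD hc
  exact hK 𝕊⁴ F h α β hD hc

/-- K1_rec ∧ K1_dyn ⇒ K1: recognise `M ≅ S⁴` by `φ`, transport `F` to `S⁴`, apply Herman rigidity there and
compose. [folklore] -/
theorem diophantineRigidity_of_recognition_of_herman (hrec : DiophantineRecognition)
    (hdyn : HermanRigiditySphereFour) : DiophantineRigidity := by
  intro M _ _ _ _ _ F h α β hD hc
  obtain ⟨φ⟩ := hrec M F h α β hD hc
  obtain ⟨ψ, hψ⟩ := hdyn (φ.symm.trans (F.trans φ)) (φ.toHomeomorph.symm.trans h) α β hD (by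
    intro y
    have := hc (φ.symm y)
    simpa [Intertwines, birot, Diffeomorph.coe_trans, Homeomorph.trans_apply] using this)
  refine ⟨φ.trans ψ, fun x => ?_⟩
  have := hψ (φ x)
  simpa [Intertwines, birot, Diffeomorph.coe_trans] using this

/-- **K1 ↔ K1_rec ∧ K1_dyn.** [folklore] -/
theorem diophantineRigidity_iff :
    DiophantineRigidity ↔ DiophantineRecognition ∧ HermanRigiditySphereFour :=
  ⟨fun h => ⟨diophantineRigidity_imp_recognition h, diophantineRigidity_imp_herman h⟩,
    fun h => diophantineRigidity_of_recognition_of_herman h.1 h.2⟩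

/-! ## §2 The recognition half is SPC4-shielded and is all the route uses -/

/-- **SPC4 ⇒ K1_rec**: the conclusion of K1_rec only depends on `M`, and `h` gives `M ≃ₕ S⁴`. [folklore] -/
theorem spc4_imp_recognition (hS : _root_.SmoothPoincare4) : DiophantineRecognition := by
  intro M _ _ _ _ _ F h α β _ _
  exact hS M ‹_› ‹_› h.toHomotopyEquiv

/-- **K1_rec → K2 → SPC4**: the route's deciding theorem with K1 weakened to K1_rec (same proof as
`closes`; the equivariance of `θ` is never used). [folklore] -/
theorem spc4_of_recognition_of_existence (hrec : DiophantineRecognition) (hE : QuasiPeriodicExistence) :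
    _root_.SmoothPoincare4 := by
  unfold _root_.SmoothPoincare4 Literature.SPC4.SmoothPoincareConjectureFour
    ContinuousMap.HomotopyEquiv.NonemptyDiffeomorphSphere
  intro M _ _ _ _ _ e
  obtain ⟨F, h, α, β, hD, hc⟩ := hE M ⟨e⟩
  exact hrec M F h α β hD hc

/-- `Target` is literally `K1 ∧ K2`. [folklore] -/
theorem target_iff_and : Target ↔ DiophantineRigidity ∧ QuasiPeriodicExistence := Iff.rfl


/-! ## §3 The bi-rotation as a diffeomorphism of `S⁴` -/

/-- `R_{α,β}` is linear. [folklore] -/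
def birotLinear (α β : ℝ) : ℝ⁵ →ₗ[ℝ] ℝ⁵ where
  toFun := birot α β
  map_add' x y := by
    ext i; fin_cases i <;> simp [birot] <;> ring
  map_smul' c x := by
    ext i; fin_cases i <;> simp [birot] <;> ring

/-- `birotLinear` acts as `birot`. [folklore] -/
@[simp] theorem birotLinear_apply (α β : ℝ) (x : ℝ⁵) : birotLinear α β x = birot α β x := rfl

/-- `R_{α,β}` preserves the inner product (`cos² + sin² = 1` in each rotation plane). [folklore] -/
theorem inner_birotLinear (α β : ℝ) (x y : ℝ⁵) :
    ⟪birotLinear α β x, birotLinear α β y⟫ = ⟪x, y⟫ := by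
  simp only [birotLinear_apply, birot, PiLp.inner_apply, Fin.sum_univ_five, RCLike.inner_apply,
    conj_trivial]
  simp
  linear_combination (x 0 * y 0 + x 1 * y 1) * Real.sin_sq_add_cos_sq (2 * Real.pi * α)
    + (x 2 * y 2 + x 3 * y 3) * Real.sin_sq_add_cos_sq (2 * Real.pi * β)

/-- `R_{α,β}` as a linear isometry equivalence of `ℝ⁵`. [folklore] -/
def birotIsometry (α β : ℝ) : ℝ⁵ ≃ₗᵢ[ℝ] ℝ⁵ :=
  ((birotLinear α β).isometryOfInner (inner_birotLinear α β)).toLinearIsometryEquiv rfl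

/-- `birotIsometry` acts as `birot`. [folklore] -/
@[simp] theorem birotIsometry_apply (α β : ℝ) (x : ℝ⁵) : birotIsometry α β x = birot α β x := rfl

/-- `finrank ℝ ℝ⁵ = 4 + 1`, the instance Mathlib's sphere charts are keyed on. -/
instance factFinrankFive : Fact (Module.finrank ℝ ℝ⁵ = 4 + 1) := ⟨finrank_euclideanSpace_fin⟩

/-- `R_{α,β}` restricted to the unit sphere: a diffeomorphism of the standard `S⁴`
(`Literature.Topology.FourManifolds.LinearIsometryEquiv.sphereDiffeomorph`). [folklore] -/
def birotSphere (α β : ℝ) : Diffeomorph (𝓡 4) (𝓡 4) 𝕊⁴ 𝕊⁴ (⊤ : ℕ∞) :=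
  Literature.Topology.FourManifolds.LinearIsometryEquiv.sphereDiffeomorph (n := 4) (birotIsometry α β)

/-- `birotSphere` acts as `birot` on coordinates. [folklore] -/
@[simp] theorem coe_birotSphere_apply (α β : ℝ) (y : 𝕊⁴) :
    ((birotSphere α β y : 𝕊⁴) : ℝ⁵) = birot α β y := rfl

/-! ## §4 A certified simultaneously Diophantine pair: `(2^{1/3}, 4^{1/3})`, `τ = 2` -/

/-- The norm form of `ℤ[2^{1/3}]` on `m + k₁·2^{1/3} + k₂·4^{1/3}`. -/
def cubicNorm (m k₁ k₂ : ℤ) : ℤ := m ^ 3 + 2 * k₁ ^ 3 + 4 * k₂ ^ 3 - 6 * m * k₁ * k₂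

/-- Infinite descent at the prime `2`: the norm form vanishes only at the origin
(i.e. `x³ − 2` is irreducible over `ℚ`). [folklore] -/
theorem cubicNorm_eq_zero_aux : ∀ n : ℕ, ∀ m k₁ k₂ : ℤ,
    m.natAbs + k₁.natAbs + k₂.natAbs ≤ n → cubicNorm m k₁ k₂ = 0 → m = 0 ∧ k₁ = 0 ∧ k₂ = 0 := by
  intro n
  induction n with
  | zero =>
    intro m k₁ k₂ hn _
    omega
  | succ n ih =>
    intro m k₁ k₂ hn hN
    unfold cubicNorm at hN
    have hm : (2 : ℤ) ∣ m := Int.prime_two.dvd_of_dvd_pow (n := 3)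
      ⟨-(k₁ ^ 3 + 2 * k₂ ^ 3 - 3 * m * k₁ * k₂), by linear_combination hN⟩
    obtain ⟨a, rfl⟩ := hm
    have hk₁ : (2 : ℤ) ∣ k₁ := Int.prime_two.dvd_of_dvd_pow (n := 3)
      ⟨-(2 * a ^ 3 + k₂ ^ 3 - 3 * a * k₁ * k₂), by
        have h2 : (2 : ℤ) * (k₁ ^ 3 - 2 * -(2 * a ^ 3 + k₂ ^ 3 - 3 * a * k₁ * k₂)) = 0 := by
          linear_combination hN
        rcases mul_eq_zero.1 h2 with h | h
        · norm_num at h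
        · linear_combination h⟩
    obtain ⟨b, rfl⟩ := hk₁
    have hk₂ : (2 : ℤ) ∣ k₂ := Int.prime_two.dvd_of_dvd_pow (n := 3)
      ⟨-(a ^ 3 + 2 * b ^ 3 - 3 * a * b * k₂), by
        have h4 : (4 : ℤ) * (k₂ ^ 3 - 2 * -(a ^ 3 + 2 * b ^ 3 - 3 * a * b * k₂)) = 0 := by
          linear_combination hN
        rcases mul_eq_zero.1 h4 with h | h
        · norm_num at h
        · linear_combination h⟩
    obtain ⟨c, rfl⟩ := hk₂
    have hN' : cubicNorm a b c = 0 := by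
      have h8 : (8 : ℤ) * (a ^ 3 + 2 * b ^ 3 + 4 * c ^ 3 - 6 * a * b * c) = 0 := by
        linear_combination hN
      rcases mul_eq_zero.1 h8 with h | h
      · norm_num at h
      · simpa [cubicNorm] using h
    by_cases h0 : a = 0 ∧ b = 0 ∧ c = 0
    · obtain ⟨rfl, rfl, rfl⟩ := h0
      simp
    · have habs : a.natAbs + b.natAbs + c.natAbs ≤ n := by
        simp only [Int.natAbs_mul] at hn
        have : (2 : ℤ).natAbs = 2 := rfl
        rw [this] at hn
        omega
      exact absurd (ih a b c habs hN') h0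

/-- The norm of `m + k₁·2^{1/3} + k₂·4^{1/3}` is a non-zero integer as soon as `(k₁, k₂) ≠ 0`. [folklore] -/
theorem cubicNorm_ne_zero {m k₁ k₂ : ℤ} (h : k₁ ≠ 0 ∨ k₂ ≠ 0) : cubicNorm m k₁ k₂ ≠ 0 := by
  intro hN
  obtain ⟨-, rfl, rfl⟩ := cubicNorm_eq_zero_aux _ m k₁ k₂ le_rfl hN
  simp at h

/-- `2^{1/3}`. -/
def cbrt2 : ℝ := (2 : ℝ) ^ ((3 : ℕ) : ℝ)⁻¹

/-- `(2^{1/3})³ = 2`. [folklore] -/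
theorem cbrt2_pow_three : cbrt2 ^ 3 = 2 :=
  Real.rpow_inv_natCast_pow (x := 2) (n := 3) (by norm_num) (by norm_num)

/-- **Liouville's inequality for `ℚ(2^{1/3})`, linear-form version**: if `θ³ = 2` then
`1/25 ≤ |k₁θ + k₂θ² + m| · (|k₁| + |k₂|)²` for all integers `(k₁, k₂) ≠ (0, 0)`, `m`.  The norm `L · Q` of
`L = m + k₁θ + k₂θ²` is a non-zero integer (`cubicNorm_ne_zero`) and the cofactor satisfies
`0 ≤ Q ≤ 25 (|k₁| + |k₂|)²` when `|L| < 1`.  (This is the content of stub `stub_cubicFrequencyDiophantine` of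
`Cruxes/QuasiPeriodicExistence/Lines/birth.lean`, obtained here as a by-product.) [folklore] -/
theorem diophantine_of_pow_three_eq_two {θ : ℝ} (hθ3 : θ ^ 3 = 2) (k₁ k₂ m : ℤ) (hk : k₁ ≠ 0 ∨ k₂ ≠ 0) :
    1 / 25 ≤ |(k₁ : ℝ) * θ + (k₂ : ℝ) * θ ^ 2 + (m : ℝ)| * (|(k₁ : ℝ)| + |(k₂ : ℝ)|) ^ 2 := by
  have hθpos : 0 < θ := by
    by_contra h
    nlinarith [mul_nonneg (neg_nonneg.2 (not_lt.1 h)) (sq_nonneg θ)]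
  have hθ2 : θ < 2 := by
    have h : θ ^ 3 < 2 ^ 3 := by rw [hθ3]; norm_num
    exact lt_of_pow_lt_pow_left₀ 3 (by norm_num) h
  have hθsq : θ ^ 2 < 2 := by
    have h : (θ ^ 2) ^ 3 < 2 ^ 3 := by
      have : (θ ^ 2) ^ 3 = (θ ^ 3) ^ 2 := by ring
      rw [this, hθ3]; norm_num
    exact lt_of_pow_lt_pow_left₀ 3 (by norm_num) h
  set u : ℝ := (k₁ : ℝ) * θ with hu
  set v : ℝ := (k₂ : ℝ) * θ ^ 2 with hv
  set L : ℝ := u + v + (m : ℝ) with hL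
  set s : ℝ := |(k₁ : ℝ)| + |(k₂ : ℝ)| with hs
  set Q : ℝ := (m : ℝ) ^ 2 + u ^ 2 + v ^ 2 - (m : ℝ) * u - (m : ℝ) * v - u * v with hQ
  have hLQ : L * Q = (cubicNorm m k₁ k₂ : ℝ) := by
    have h6 : θ ^ 6 = 4 := by
      calc θ ^ 6 = (θ ^ 3) ^ 2 := by ring
        _ = 4 := by rw [hθ3]; norm_num
    simp only [hL, hQ, hu, hv, cubicNorm]
    push_cast
    linear_combination ((k₁ : ℝ) ^ 3 - 3 * (m : ℝ) * (k₁ : ℝ) * (k₂ : ℝ)) * hθ3 + (k₂ : ℝ) ^ 3 * h6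
  have hN : cubicNorm m k₁ k₂ ≠ 0 := cubicNorm_ne_zero hk
  have hN1 : (1 : ℝ) ≤ |(cubicNorm m k₁ k₂ : ℝ)| := by exact_mod_cast Int.one_le_abs hN
  have hLQabs : 1 ≤ |L| * |Q| := by rw [← abs_mul, hLQ]; exact hN1
  have hs1 : (1 : ℝ) ≤ s := by
    rcases hk with h | h
    · have : (1 : ℝ) ≤ |(k₁ : ℝ)| := by exact_mod_cast Int.one_le_abs h
      linarith [abs_nonneg (k₂ : ℝ)]
    · have : (1 : ℝ) ≤ |(k₂ : ℝ)| := by exact_mod_cast Int.one_le_abs h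
      linarith [abs_nonneg (k₁ : ℝ)]
  have hua : |u| ≤ 2 * |(k₁ : ℝ)| := by
    rw [hu, abs_mul, abs_of_pos hθpos]; nlinarith [abs_nonneg (k₁ : ℝ)]
  have hva : |v| ≤ 2 * |(k₂ : ℝ)| := by
    rw [hv, abs_mul, abs_of_pos (by positivity : 0 < θ ^ 2)]; nlinarith [abs_nonneg (k₂ : ℝ)]
  by_cases hL1 : 1 ≤ |L|
  · have : 1 ≤ s ^ 2 := by nlinarith
    nlinarith [abs_nonneg L]
  · push Not at hL1
    have hm : |(m : ℝ)| ≤ 3 * s := by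
      have e : (m : ℝ) = L - u - v := by rw [hL]; ring
      have h1 : |(m : ℝ)| ≤ |L| + |u| + |v| := by
        rw [e]
        calc |L - u - v| ≤ |L - u| + |v| := abs_sub _ _
          _ ≤ |L| + |u| + |v| := by linarith [abs_sub L u]
      linarith
    have hQ0 : 0 ≤ Q := by
      have e : Q = (((m : ℝ) - u) ^ 2 + ((m : ℝ) - v) ^ 2 + (u - v) ^ 2) / 2 := by rw [hQ]; ring
      rw [e]; positivity
    have hQle : Q ≤ (|(m : ℝ)| + |u| + |v|) ^ 2 := by
      have e1 : (m : ℝ) ^ 2 = |(m : ℝ)| ^ 2 := (sq_abs _).symm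
      have e2 : u ^ 2 = |u| ^ 2 := (sq_abs _).symm
      have e3 : v ^ 2 = |v| ^ 2 := (sq_abs _).symm
      have f1 : -((m : ℝ) * u) ≤ |(m : ℝ)| * |u| := by rw [← abs_mul]; exact neg_le_abs _
      have f2 : -((m : ℝ) * v) ≤ |(m : ℝ)| * |v| := by rw [← abs_mul]; exact neg_le_abs _
      have f3 : -(u * v) ≤ |u| * |v| := by rw [← abs_mul]; exact neg_le_abs _
      have g1 := mul_nonneg (abs_nonneg (m : ℝ)) (abs_nonneg u)
      have g2 := mul_nonneg (abs_nonneg (m : ℝ)) (abs_nonneg v)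
      have g3 := mul_nonneg (abs_nonneg u) (abs_nonneg v)
      rw [hQ]; nlinarith
    have hT : |(m : ℝ)| + |u| + |v| ≤ 5 * s := by linarith
    have hQ25 : |Q| ≤ 25 * s ^ 2 := by
      rw [abs_of_nonneg hQ0]
      calc Q ≤ (|(m : ℝ)| + |u| + |v|) ^ 2 := hQle
        _ ≤ (5 * s) ^ 2 := by gcongr
        _ = 25 * s ^ 2 := by ring
    have h25 : 1 ≤ |L| * (25 * s ^ 2) := le_trans hLQabs (by gcongr)
    nlinarith [abs_nonneg L]

/-- Every real `θ` with `θ³ = 2` gives a simultaneously Diophantine pair `(θ, θ²)` in the route's sense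
(`τ = 2`, `γ = 1/25`). [folklore] -/
theorem isDiophantinePair_of_pow_three_eq_two {θ : ℝ} (hθ3 : θ ^ 3 = 2) : IsDiophantinePair θ (θ ^ 2) := by
  refine ⟨1 / 25, 2, by norm_num, fun k₁ k₂ m hk => ?_⟩
  rw [Real.rpow_two]
  exact diophantine_of_pow_three_eq_two hθ3 k₁ k₂ m hk

/-- **A certified simultaneously Diophantine pair**: `(2^{1/3}, 4^{1/3})`. [folklore] -/
theorem isDiophantinePair_cbrt2 : IsDiophantinePair cbrt2 (cbrt2 ^ 2) :=
  isDiophantinePair_of_pow_three_eq_two cbrt2_pow_three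

/-! ## §5 SPC4 ⇒ K2, and the balance sheet -/

/-- **SPC4 ⇒ K2 (`QuasiPeriodicExistence`)**: if `θ : M ≅ S⁴` then `F := θ⁻¹ ∘ R_{α,β} ∘ θ` and `h := θ` do,
with the certified Diophantine pair `(2^{1/3}, 4^{1/3})`.  So K2 is SPC4-shielded too (its own docstring says as
much; this is the kernel-checked form, and it discharges K2 outright on the standard `S⁴`). [folklore] -/
theorem spc4_imp_quasiPeriodicExistence (hS : _root_.SmoothPoincare4) : QuasiPeriodicExistence := by
  intro M _ _ _ _ _ hM
  obtain ⟨e⟩ := hM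
  obtain ⟨θ⟩ := hS M ‹_› ‹_› e
  refine ⟨θ.trans ((birotSphere cbrt2 (cbrt2 ^ 2)).trans θ.symm), θ.toHomeomorph, cbrt2, cbrt2 ^ 2,
    isDiophantinePair_cbrt2, fun x => ?_⟩
  simp [Diffeomorph.coe_trans, birot]

/-- **K1_rec ∧ K2 ↔ SPC4**: the two load-bearing pieces of the route are JOINTLY equivalent to the summit and EACH
is implied by it (`spc4_imp_recognition`, `spc4_imp_quasiPeriodicExistence`) — an unassigned conjunct split. [folklore] -/
theorem recognition_and_existence_iff_spc4 :
    (DiophantineRecognition ∧ QuasiPeriodicExistence) ↔ _root_.SmoothPoincare4 :=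
  ⟨fun h => spc4_of_recognition_of_existence h.1 h.2,
    fun h => ⟨spc4_imp_recognition h, spc4_imp_quasiPeriodicExistence h⟩⟩

/-- Given K1, the remaining crux K2 is literally equivalent to the summit. [folklore] -/
theorem quasiPeriodicExistence_iff_spc4_of_rigidity (hK : DiophantineRigidity) :
    QuasiPeriodicExistence ↔ _root_.SmoothPoincare4 :=
  ⟨fun hE => spc4_of_recognition_of_existence (diophantineRigidity_imp_recognition hK) hE,
    spc4_imp_quasiPeriodicExistence⟩

/-- **The route's target `K1 ∧ K2` is exactly `SPC4 ∧ (Herman rigidity on the standard S⁴)`**: the summit plus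
an independent open problem of smooth dynamics which the deciding theorem throws away. [folklore] -/
theorem target_iff : Target ↔ _root_.SmoothPoincare4 ∧ HermanRigiditySphereFour := by
  rw [target_iff_and, diophantineRigidity_iff]
  constructor
  · rintro ⟨⟨hrec, hdyn⟩, hE⟩
    exact ⟨spc4_of_recognition_of_existence hrec hE, hdyn⟩
  · rintro ⟨hS, hdyn⟩
    exact ⟨⟨spc4_imp_recognition hS, hdyn⟩, spc4_imp_quasiPeriodicExistence hS⟩

/-- **Modulo the summit, K1 is Herman's problem and nothing else**: `SPC4 → (K1 ↔ K1_dyn)`. [folklore] -/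
theorem diophantineRigidity_iff_herman_of_spc4 (hS : _root_.SmoothPoincare4) :
    DiophantineRigidity ↔ HermanRigiditySphereFour := by
  rw [diophantineRigidity_iff]
  exact ⟨And.right, fun h => ⟨spc4_imp_recognition hS, h⟩⟩

end Summit.SmoothPoincare4.SmoothPoincare4.Theorems.DiophantineRigidity.Negative
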